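import Literature.AlgebraicGeometry.Morphisms.CechModuleShortExact
import Literature.AlgebraicGeometry.Morphisms.CechModuleH2
import Literature.AlgebraicGeometry.Morphisms.CechModuleUnit
import Literature.AlgebraicGeometry.Modules.SheafHomLeft
import Mathlib.Algebra.Category.ModuleCat.Sheaf.Free
import Mathlib.CategoryTheory.Limits.Shapes.Biproducts
import HarnessLib

/-!
# `Ȟ¹` of finite direct sums and of free modules of finite rank; `Ȟ¹` of a quotient of `𝒪_X^I`

Sequel of `Morphisms/CechModule*` (Čech cochains of a sheaf of `𝒪_X`-modules `M` on a family of
opens `𝒰` of an `A`-scheme `f : X → Spec A`; the long exact sequence in degrees `≤ 1` of a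
sectionwise exact `M′ → M → M″`; right exactness of `Ȟ¹` where `Ȟ² = 0`) and of the Čech section of
`Modules/SheafHomLeft` (`Ȟ¹(𝒰, –)` is an ADDITIVE functor of the sheaf: `cechMapH1_add_apply`,
invariance under isomorphism, vanishing on zero modules, binary biproducts through `𝓗om`). The Čech
complex being additive in the sheaf (The Stacks Project, Tag 01ED: "the Čech complex is functorial
in the sheaf"), the biproduct identity `∑ⱼ πⱼ ιⱼ = 𝟙` gives:

* `cechMapH1_sum_apply` — `Ȟ¹(∑ⱼ φⱼ) = ∑ⱼ Ȟ¹(φⱼ)`;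
* `subsingleton_cechMH1_biproduct` — **`Ȟ¹(𝒰, ⨁ⱼ Fⱼ) = 0` if all `Ȟ¹(𝒰, Fⱼ) = 0`** (`J` finite):
  every class `x` equals `∑ⱼ Ȟ¹(ιⱼ)(Ȟ¹(πⱼ) x)` and the inner classes vanish;
* `subsingleton_cechMH1_free`, `subsingleton_cechMH1_of_iso_free` — **`Ȟ¹(𝒰, 𝒪_X^I) = 0` (`I`
  finite) as soon as `Ȟ¹(𝒰, 𝒪_X) = 0`** (`free I ≅ ⨁_I 𝒪_X`, Mathlib `biproduct.isoCoproduct`;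
  `Ȟ¹(𝒰, 𝒪_X)` = the structure-sheaf `CechH1` of `Morphisms/CechH1`, `CechMH1_unit`);
* `subsingleton_cechMH1_of_shortExact_of_iso_free` — **`Ȟ¹` OF A QUOTIENT OF `𝒪_X^I`**: for a short
  exact `0 → K → P → G → 0` with `P ≅ 𝒪_X^I` (`I` finite) and `K` affine-localizing (quasi-coherent),
  on a family of affine opens with affine pairwise intersections on which `Ȟ¹(𝒰, 𝒪_X) = 0` and
  `Ȟ²(𝒰, K) = 0`: `Ȟ¹(𝒰, G) = 0` (right exactness of `Ȟ¹`, `Morphisms/CechModuleH2`, applied to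
  `Ȟ¹(𝒰, P) = 0`; sectionwise exactness on the affine `U_i`, `U_i ∩ U_j` by
  `Morphisms/CechModuleShortExact`) — the form in which «`M` generated by finitely many global
  sections + `H¹(𝒪_X) = 0` + `H² = 0` ⇒ `H¹(M) = 0`» is used for full sheaves on a rational surface
  singularity (Artin–Verdier 1985, Lemma (1.1); chain W4.4 of cell res-hironaka, crux `NoZenoR`
  stmt-ResolutionOfSingularities-19943, G2 (iii)); `…_of_isSeparated` — cover form on a separated `X`.

Everything is proved; no named facts. Mathlib searched (pin v4.32): `biproduct.total`,
`biproduct.isoCoproduct`, `SheafOfModules.free` (used); no Čech cohomology of sheaves of modules on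
schemes (cf. `CechModule.lean`).

## References

* The Stacks Project, Tag 01ED (Cohomology, Section 20.9: the Čech complex and its functoriality).
  [StacksProject]
* R. Hartshorne, *Algebraic Geometry*, GTM 52 (1977): III §4, proof of Thm. 4.5 (p. 222).
  [Hartshorne1977]
* M. Artin, J.-L. Verdier, *Reflexive modules over rational double points*, Math. Ann. 270 (1985)
  79–82: Lemma (1.1) (context for the last item). [ArtinVerdier1985]
-/

noncomputable section

open CategoryTheory AlgebraicGeometry Limits TopologicalSpace Opposite
open Literature.AlgebraicGeometry.Modules

universe u v w

namespace Literature.AlgebraicGeometry.Morphisms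

variable {A : Type u} [CommRing A] {X : Scheme.{u}} (f : X ⟶ Spec (.of A)) {ι : Type v}
  (U : ι → X.Opens)

/-! ## `Ȟ¹` of finite sums of morphisms and of finite direct sums -/

/-- **`Ȟ¹(𝒰, –)` is additive on finite sums of morphisms**: `Ȟ¹(∑_{j ∈ s} φⱼ) x = ∑_{j ∈ s} Ȟ¹(φⱼ) x`.
[cite: StacksProject, Tag 01ED (Cohomology, Section 20.9)] -/
theorem cechMapH1_sum_apply {M N : X.Modules} {J : Type w} (s : Finset J) (φ : J → (M ⟶ N))
    (x : CechMH1 f M U) :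
    cechMapH1 f (∑ j ∈ s, φ j) U x = ∑ j ∈ s, cechMapH1 f (φ j) U x := by
  classical
  induction s using Finset.induction_on with
  | empty => rw [Finset.sum_empty, Finset.sum_empty, cechMapH1_zero]
  | insert j s hj ih => rw [Finset.sum_insert hj, Finset.sum_insert hj, cechMapH1_add_apply, ih]

/-- **`Ȟ¹` of a finite direct sum vanishes if it vanishes on the summands**: for a finite family
`F : J → Mod(𝒪_X)` with `Ȟ¹(𝒰, Fⱼ) = 0` for all `j`, `Ȟ¹(𝒰, ⨁ⱼ Fⱼ) = 0` — every class `x` equals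
`Ȟ¹(∑ⱼ πⱼ ιⱼ) x = ∑ⱼ Ȟ¹(ιⱼ)(Ȟ¹(πⱼ) x)` (`biproduct.total` / `IsBilimit.total`) and `Ȟ¹(πⱼ) x ∈ Ȟ¹(𝒰, Fⱼ) = 0`.
[cite: StacksProject, Tag 01ED (Cohomology, Section 20.9)] -/
theorem subsingleton_cechMH1_biproduct {J : Type w} [Finite J] (F : J → X.Modules) [HasBiproduct F]
    (hF : ∀ j, Subsingleton (CechMH1 f (F j) U)) : Subsingleton (CechMH1 f (⨁ F) U) := by
  classical
  cases nonempty_fintype J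
  refine subsingleton_of_forall_eq 0 fun x => ?_
  have hzero : ∀ j, cechMapH1 f (biproduct.π F j) U x = 0 := fun j => Subsingleton.elim _ _
  -- `∑ⱼ πⱼ ιⱼ = 𝟙` (Mathlib `biproduct.total`, in the universe-polymorphic form `IsBilimit.total`)
  have htot : ∑ j, biproduct.π F j ≫ biproduct.ι F j = 𝟙 (⨁ F) :=
    Limits.IsBilimit.total (biproduct.isBilimit F)
  rw [← cechMapH1_id_apply f U x, ← htot, cechMapH1_sum_apply]
  refine Finset.sum_eq_zero fun j _ => ?_
  rw [cechMapH1_comp, hzero j, map_zero]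

/-! ## Free modules of finite rank -/

/-- **`Ȟ¹(𝒰, 𝒪_X^I) = 0` for `I` finite if `Ȟ¹(𝒰, 𝒪_X) = 0`** (`𝒪_X^I = SheafOfModules.free I ≅ ⨁_I 𝒪_X`;
`Ȟ¹(𝒰, 𝒪_X)` is the structure-sheaf `CechH1 f 𝒰` of `Morphisms/CechH1`).
[cite: StacksProject, Tag 01ED (Cohomology, Section 20.9)] -/
theorem subsingleton_cechMH1_free (I : Type u) [Finite I] (hO : Subsingleton (CechH1 f U)) :
    Subsingleton (CechMH1 f (SheafOfModules.free (R := X.ringCatSheaf) I) U) := by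
  haveI : HasFiniteBiproducts X.Modules := HasFiniteBiproducts.of_hasFiniteProducts
  have hunit : Subsingleton (CechMH1 f (SheafOfModules.unit X.ringCatSheaf) U) := by
    rwa [CechMH1_unit]
  have hsum : Subsingleton (CechMH1 f (⨁ fun _ : I => (SheafOfModules.unit X.ringCatSheaf :
      X.Modules)) U) :=
    subsingleton_cechMH1_biproduct f U _ fun _ => hunit
  -- `free I = ∐_I 𝒪_X ≅ ⨁_I 𝒪_X` (finite index type)
  exact subsingleton_cechMH1_of_iso f U (biproduct.isoCoproduct _).symm hsum

/-- The same for a module isomorphic to `𝒪_X^I`, `I` finite.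
[cite: StacksProject, Tag 01ED (Cohomology, Section 20.9)] -/
theorem subsingleton_cechMH1_of_iso_free {P : X.Modules} {I : Type u} [Finite I]
    (e : P ≅ SheafOfModules.free (R := X.ringCatSheaf) I) (hO : Subsingleton (CechH1 f U)) :
    Subsingleton (CechMH1 f P U) :=
  subsingleton_cechMH1_of_iso f U e (subsingleton_cechMH1_free f U I hO)

/-! ## `Ȟ¹` of a quotient of `𝒪_X^I` -/

/-- **`Ȟ¹` of a quotient of a free module of finite rank.** Let `0 → K → P → G → 0` be a short exact
sequence of `𝒪_X`-modules with `P ≅ 𝒪_X^I`, `I` finite, and `K` affine-localizing (e.g.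
quasi-coherent); let `𝒰` be a family of affine opens with affine pairwise intersections such that
`Ȟ¹(𝒰, 𝒪_X) = 0` and `Ȟ²(𝒰, K) = 0`. Then `Ȟ¹(𝒰, G) = 0`: `Ȟ¹(𝒰, P) = 0`
(`subsingleton_cechMH1_of_iso_free`) maps ONTO `Ȟ¹(𝒰, G)` (right exactness of `Ȟ¹` where `Ȟ² = 0`,
`CechExactData.cechMapH1_surjective_of_subsingleton_cechMH2`, the sequence being sectionwise exact on
the affine `U_i`, `U_i ∩ U_j` by `Morphisms/CechModuleShortExact`).
[cite: Hartshorne1977, III Thm. 4.5 proof p. 222 (PDF p. 278)] -/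
theorem subsingleton_cechMH1_of_shortExact_of_iso_free {S : ShortComplex X.Modules}
    (hS : S.ShortExact) {I : Type u} [Finite I] (e : S.X₂ ≅ SheafOfModules.free (R := X.ringCatSheaf) I)
    (h₁ : IsAffineLocalizing S.X₁) (hU : ∀ i, IsAffineOpen (U i))
    (hU2 : ∀ i j, IsAffineOpen (U i ⊓ U j)) (hO : Subsingleton (CechH1 f U))
    (hH2 : Subsingleton (CechMH2 f S.X₁ U)) : Subsingleton (CechMH1 f S.X₃ U) := by
  have hP : Subsingleton (CechMH1 f S.X₂ U) := subsingleton_cechMH1_of_iso_free f U e hO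
  have hsurj : Function.Surjective (cechMapH1 f S.g U) :=
    (CechExactData.of_shortExact f U hS h₁ hU).cechMapH1_surjective_of_subsingleton_cechMH2
      (fun i j => app_surjective_of_shortExact hS h₁ (hU2 i j)) hH2
  refine ⟨fun x y => ?_⟩
  obtain ⟨x', rfl⟩ := hsurj x
  obtain ⟨y', rfl⟩ := hsurj y
  rw [Subsingleton.elim x' y']

/-- **`Ȟ¹` of a quotient of `𝒪_X^I` on a separated scheme**, cover form: for `X` separated, a short
exact `0 → K → P → G → 0` with `P ≅ 𝒪_X^I` (`I` finite) and `K` affine-localizing, and a family of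
affine opens `𝒰` with `Ȟ¹(𝒰, 𝒪_X) = 0` and `Ȟ²(𝒰, K) = 0`: `Ȟ¹(𝒰, G) = 0`.
[cite: Hartshorne1977, III Thm. 4.5 proof p. 222 (PDF p. 278)] -/
theorem subsingleton_cechMH1_of_shortExact_of_iso_free_of_isSeparated [X.IsSeparated]
    {S : ShortComplex X.Modules} (hS : S.ShortExact) {I : Type u} [Finite I]
    (e : S.X₂ ≅ SheafOfModules.free (R := X.ringCatSheaf) I) (h₁ : IsAffineLocalizing S.X₁)
    (hU : ∀ i, IsAffineOpen (U i)) (hO : Subsingleton (CechH1 f U))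
    (hH2 : Subsingleton (CechMH2 f S.X₁ U)) : Subsingleton (CechMH1 f S.X₃ U) :=
  subsingleton_cechMH1_of_shortExact_of_iso_free f U hS e h₁ hU (fun i j => (hU i).inf (hU j)) hO hH2

end Literature.AlgebraicGeometry.Morphisms

end
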